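import Mathlib
import HarnessLib
import Literature.MathematicalPhysics.StatisticalMechanics.RenormalisationStepAlgebra
import Literature.MathematicalPhysics.StatisticalMechanics.TorusPolymerTranslations
import Literature.MathematicalPhysics.StatisticalMechanics.WeightIntegrationMapABKM
import Literature.Probability.Distributions.GaussianLinearCompensation
import Literature.MathematicalPhysics.StatisticalMechanics.TorusDiscreteLeibniz

/-!
# Translation invariance of the renormalised perturbation ([ABKM19] Lemma 6.4 (1))

[ABKM19] Lemma 6.4 (1): if `K` is translation invariant on scale `k` —
`K(τ_a X, τ_a φ) = K(X, φ)` for `a ∈ (L^kℤ)^d`, `τ_a X = X + a`, `(τ_a φ)(x) = φ(x − a)` — and the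
relevant Hamiltonians are (they are translation invariant under all of `ℤ^d`), then `K_{k+1}` of
Definition 6.5 / (6.34) is translation invariant on scale `k+1`, because the reblocking map `π` is
`(L^{k+1}ℤ)^d`-covariant and the fluctuation measure `μ_{k+1}` (translation-invariant covariance)
is invariant under `τ_a`.

* `fieldShift a φ = φ(· − a)` (`τ_a` on fields), `fieldShiftEquiv` (a measurable equivalence),
  `TransInv s F` (`F(X + a, τ_a φ) = F(X, φ)` for `a ∈ (sℤ)^d`);
* `polys_translate`, `bprod_translate`, `pcirc_translate`, `midK_translate` — the pieces of
  (6.34) are covariant;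
* `shiftMat`, `shiftMat_mul_circulant_mul_transpose`, **`map_fieldShift_stepMeasure`** — the step
  measure `N(0, circulant 𝒞)` is invariant under `τ_a` (`P_a 𝒞 P_aᵀ = 𝒞` for the permutation
  matrix of `x ↦ x − a`); `integral_fieldShift_eq` for any `τ_a`-invariant measure;
* **`nextK_translate`** — Lemma 6.4 (1): `K_{k+1}(U + c, τ_c φ) = K_{k+1}(U, φ)` for `c ∈ (s'ℤ)^d`,
  given a covariant `π`, translation-invariant `I, Ĩ, K` and a `τ`-invariant `μ`
  (`transInv_cexp_neg_eval`: `e^{−H(B,·)}` is translation invariant for `H ∈ M_0`).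

Everything is proved; no named fact.

## References
* S. Adams, S. Buchholz, R. Kotecký, S. Müller, arXiv:1910.13564, Ch. 6.2 (translation invariance
  of functionals), Lemma 6.4 (1) [AdamsBuchholzKoteckyMuller2019].
-/

noncomputable section

namespace Literature.MathematicalPhysics.StatisticalMechanics.GradientRG

open scoped BigOperators Classical Matrix
open Finset MeasureTheory
open Literature.MathematicalPhysics.StatisticalMechanics.TorusPolymer
  hiding translate translate_translate translate_zero translate_empty translate_union translate_sdiff
    translate_inj translate_biUnion translate_subset_translate_iff mem_translate add_mem_translate_iff
    card_translate
open Literature.MathematicalPhysics.StatisticalMechanics.GradientFRD (fwdDiff iterDiff)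
open Literature.Probability.Distributions (matrixCLM multivariateGaussian_map_matrix ofLp_matrixCLM)

variable {d M : ℕ}

/-! ## Translations of fields -/

/-- `τ_a` on fields: `(τ_a φ)(x) = φ(x − a)`. [cite: AdamsBuchholzKoteckyMuller2019, Ch. 6.2] -/
def fieldShift (a : Fin d → ZMod M) (φ : (Fin d → ZMod M) → ℝ) : (Fin d → ZMod M) → ℝ :=
  fun x => φ (x - a)

/-- `fieldShift a` is Mathlib's `translate a` on field configurations (kept under its own name to
avoid the clash with `TorusPolymer.translate` on sets). [cite: AdamsBuchholzKoteckyMuller2019, Ch. 6.2] -/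
theorem fieldShift_eq_translate (a : Fin d → ZMod M) (φ : (Fin d → ZMod M) → ℝ) :
    fieldShift a φ = _root_.translate a φ := rfl

/-- `τ_a φ (x) = φ (x − a)`. [cite: AdamsBuchholzKoteckyMuller2019, Ch. 6.2] -/
@[simp] theorem fieldShift_apply (a : Fin d → ZMod M) (φ : (Fin d → ZMod M) → ℝ) (x : Fin d → ZMod M) :
    fieldShift a φ x = φ (x - a) := rfl

/-- `τ_0 = id`. [cite: AdamsBuchholzKoteckyMuller2019, Ch. 6.2] -/
@[simp] theorem fieldShift_zero (φ : (Fin d → ZMod M) → ℝ) : fieldShift 0 φ = φ := by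
  funext x; simp

/-- `τ_b ∘ τ_a = τ_{a+b}`. [cite: AdamsBuchholzKoteckyMuller2019, Ch. 6.2] -/
theorem fieldShift_fieldShift (a b : Fin d → ZMod M) (φ : (Fin d → ZMod M) → ℝ) :
    fieldShift b (fieldShift a φ) = fieldShift (a + b) φ := by
  funext x; simp only [fieldShift_apply]; congr 1; abel

/-- `τ_a` is additive in the field. [cite: AdamsBuchholzKoteckyMuller2019, Ch. 6.2] -/
theorem fieldShift_add (a : Fin d → ZMod M) (φ ψ : (Fin d → ZMod M) → ℝ) :
    fieldShift a (φ + ψ) = fieldShift a φ + fieldShift a ψ := rfl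

/-- `τ_a` as a measurable equivalence of field space (inverse `τ_{−a}`).
[cite: AdamsBuchholzKoteckyMuller2019, Ch. 6.2] -/
def fieldShiftEquiv (a : Fin d → ZMod M) : ((Fin d → ZMod M) → ℝ) ≃ᵐ ((Fin d → ZMod M) → ℝ) where
  toFun := fieldShift a
  invFun := fieldShift (-a)
  left_inv φ := by rw [fieldShift_fieldShift, add_neg_cancel, fieldShift_zero]
  right_inv φ := by rw [fieldShift_fieldShift, neg_add_cancel, fieldShift_zero]
  measurable_toFun := measurable_pi_lambda _ fun x => measurable_pi_apply (x - a)
  measurable_invFun := measurable_pi_lambda _ fun x => measurable_pi_apply (x - -a)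

/-- `fieldShiftEquiv a = τ_a` as a function. [cite: AdamsBuchholzKoteckyMuller2019, Ch. 6.2] -/
@[simp] theorem coe_fieldShiftEquiv (a : Fin d → ZMod M) :
    ⇑(fieldShiftEquiv a) = fieldShift a := rfl

/-- **Translation invariance on scale `k`** of a polymer (or one-block) functional:
`F(X + a, τ_a φ) = F(X, φ)` for all `a ∈ (sℤ)^d` (`s = L^k`).
[cite: AdamsBuchholzKoteckyMuller2019, Ch. 6.2 (translation invariance of F ∈ M(𝓟_k))] -/
def TransInv {𝔸 : Type*} (s : ℕ) (F : Finset (Fin d → ZMod M) → ((Fin d → ZMod M) → ℝ) → 𝔸) : Prop :=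
  ∀ a : Fin d → ZMod M, IsLatticeVec s a → ∀ (X : Finset (Fin d → ZMod M)) (φ : (Fin d → ZMod M) → ℝ),
    F (TorusPolymer.translate a X) (fieldShift a φ) = F X φ

/-- Invariance on a finer scale implies invariance on a coarser one (`(s'ℤ)^d ⊆ (sℤ)^d`).
[cite: AdamsBuchholzKoteckyMuller2019, Ch. 6.2] -/
theorem TransInv.of_dvd {𝔸 : Type*} {s s' : ℕ} (h : s ∣ s')
    {F : Finset (Fin d → ZMod M) → ((Fin d → ZMod M) → ℝ) → 𝔸} (hF : TransInv s F) : TransInv s' F :=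
  fun a ha X φ => hF a (ha.of_dvd h) X φ

/-! ## Translation invariance of relevant Hamiltonians -/

/-- `τ_a = shiftFn (−a)` (the tree's `f(· + v)`). [cite: AdamsBuchholzKoteckyMuller2019, Ch. 6.2] -/
theorem fieldShift_eq_shiftFn (a : Fin d → ZMod M) (φ : (Fin d → ZMod M) → ℝ) :
    fieldShift a φ = shiftFn (-a) φ := by
  funext x; simp [fieldShift, shiftFn, sub_eq_add_neg]

/-- Iterated differences commute with translations: `∇^α(τ_a φ)(x + a) = ∇^α φ(x)`.
[cite: AdamsBuchholzKoteckyMuller2019, Ch. 6.2] -/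
theorem iterDiff_fieldShift_add (α : Fin d → ℕ) (a : Fin d → ZMod M) (φ : (Fin d → ZMod M) → ℝ)
    (x : Fin d → ZMod M) : iterDiff α (fieldShift a φ) (x + a) = iterDiff α φ x := by
  rw [fieldShift_eq_shiftFn, iterDiff_shiftFn]
  simp [shiftFn]

/-- Forward differences commute with translations: `∇_i(τ_a φ)(x + a) = ∇_i φ(x)`.
[cite: AdamsBuchholzKoteckyMuller2019, Ch. 6.2] -/
theorem fwdDiff_fieldShift_add (i : Fin d) (a : Fin d → ZMod M) (φ : (Fin d → ZMod M) → ℝ)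
    (x : Fin d → ZMod M) : fwdDiff i (fieldShift a φ) (x + a) = fwdDiff i φ x := by
  simp only [GradientFRD.fwdDiff, fieldShift_apply]
  congr 2 <;> abel

/-- The relevant monomials are translation invariant. [cite: AdamsBuchholzKoteckyMuller2019, Ch. 6.2] -/
theorem relMonomial_fieldShift_add (ι : RelIndex d) (a : Fin d → ZMod M) (φ : (Fin d → ZMod M) → ℝ)
    (x : Fin d → ZMod M) : relMonomial ι (fieldShift a φ) (x + a) = relMonomial ι φ x := by
  rcases ι with u | α | q
  · rfl
  · simp only [relMonomial_lin, iterDiff_fieldShift_add]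
  · simp only [relMonomial_quad, fwdDiff_fieldShift_add]

/-- **Relevant Hamiltonians are translation invariant** (under all of `ℤ^d`):
`H(B + a, τ_a φ) = H(B, φ)`. [cite: AdamsBuchholzKoteckyMuller2019, Ch. 6.2 (M_0 ⊂ M(𝓑_k))] -/
theorem eval_translate_fieldShift {𝕜 : Type*} [CommRing 𝕜] [Algebra ℝ 𝕜] (H : RelevantHamiltonian 𝕜 d)
    (a : Fin d → ZMod M) (B : Finset (Fin d → ZMod M)) (φ : (Fin d → ZMod M) → ℝ) :
    eval H (TorusPolymer.translate a B) (fieldShift a φ) = eval H B φ := by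
  rw [eval, eval]
  unfold TorusPolymer.translate
  rw [Finset.sum_image fun x _ x' _ h => add_right_cancel h]
  refine Finset.sum_congr rfl fun x _ => ?_
  simp only [density, relMonomial_fieldShift_add]

/-- `e^{−H(B,·)}` is translation invariant on every scale (`𝕜 = ℂ`).
[cite: AdamsBuchholzKoteckyMuller2019, Ch. 6.2 (M_0 ⊂ M(𝓑_k))] -/
theorem transInv_cexp_neg_eval (s : ℕ) (H : RelevantHamiltonian ℂ d) :
    TransInv s (fun (B : Finset (Fin d → ZMod M)) (φ : (Fin d → ZMod M) → ℝ) =>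
      Complex.exp (-(eval H B φ))) :=
  fun a _ B φ => by simp only [eval_translate_fieldShift]

/-! ## The pieces of (6.34) are covariant -/

section Pieces

variable [NeZero M] {𝕜 : Type*} [RCLike 𝕜]

/-- `Λ + a = Λ`. [cite: AdamsBuchholzKoteckyMuller2019, Ch. 6.2] -/
@[simp] theorem translate_univ (a : Fin d → ZMod M) :
    TorusPolymer.translate a (univ : Finset (Fin d → ZMod M)) = univ :=
  eq_univ_of_forall fun _ => TorusPolymer.mem_translate.2 (mem_univ _)

/-- **Polymer subsets translate**: `𝓟_k(X + a) = 𝓟_k(X) + a` for `a ∈ (sℤ)^d`.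
[cite: AdamsBuchholzKoteckyMuller2019, Ch. 6.2] -/
theorem polys_translate {s t : ℕ} (hMst : M = s * t) (hs : Odd s) (ht : Odd t)
    {a : Fin d → ZMod M} (ha : IsLatticeVec s a) (X : Finset (Fin d → ZMod M)) :
    polys s (TorusPolymer.translate a X) = (polys s X).image (TorusPolymer.translate a) := by
  ext Y
  rw [mem_polys, mem_image]
  constructor
  · rintro ⟨hYX, hY⟩
    refine ⟨TorusPolymer.translate (-a) Y, mem_polys.2 ⟨?_, isPolymer_translate hMst hs ht ha.neg hY⟩, ?_⟩
    · have := TorusPolymer.translate_subset_translate_iff (a := -a) |>.2 hYX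
      rwa [TorusPolymer.translate_translate, add_neg_cancel, TorusPolymer.translate_zero] at this
    · rw [TorusPolymer.translate_translate, neg_add_cancel, TorusPolymer.translate_zero]
  · rintro ⟨Y', hY', rfl⟩
    obtain ⟨hY'X, hY'p⟩ := mem_polys.1 hY'
    exact ⟨TorusPolymer.translate_subset_translate_iff.2 hY'X, isPolymer_translate hMst hs ht ha hY'p⟩

/-- **Block products are covariant**: `F^{X+a}(τ_a φ) = F^X(φ)` for translation-invariant `F`,
`a ∈ (sℤ)^d`. [cite: AdamsBuchholzKoteckyMuller2019, Lemma 6.4 (1)] -/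
theorem bprod_translate {s t : ℕ} (hMst : M = s * t) (hs : Odd s) (ht : Odd t)
    {F : Finset (Fin d → ZMod M) → ((Fin d → ZMod M) → ℝ) → 𝕜} (hF : TransInv s F)
    {a : Fin d → ZMod M} (ha : IsLatticeVec s a) (X : Finset (Fin d → ZMod M))
    (φ : (Fin d → ZMod M) → ℝ) :
    bprod s (fun B => F B (fieldShift a φ)) (TorusPolymer.translate a X) = bprod s (fun B => F B φ) X := by
  rw [bprod, bprod, blocks_translate hMst hs ht ha, Finset.prod_image fun B _ B' _ h => TorusPolymer.translate_inj h]
  exact Finset.prod_congr rfl fun B _ => hF a ha B φ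

/-- **Circle products are covariant.** [cite: AdamsBuchholzKoteckyMuller2019, Lemma 6.4 (1)] -/
theorem pcirc_translate {s t : ℕ} (hMst : M = s * t) (hs : Odd s) (ht : Odd t)
    {a : Fin d → ZMod M} (ha : IsLatticeVec s a) (F G F' G' : Finset (Fin d → ZMod M) → 𝕜)
    (X : Finset (Fin d → ZMod M)) (hF : ∀ Y ∈ polys s X, F' (TorusPolymer.translate a Y) = F Y)
    (hG : ∀ Y ∈ polys s X, G' (TorusPolymer.translate a (X \ Y)) = G (X \ Y)) :
    pcirc s F' G' (TorusPolymer.translate a X) = pcirc s F G X := by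
  rw [pcirc, pcirc, polys_translate hMst hs ht ha, Finset.sum_image fun Y _ Y' _ h => TorusPolymer.translate_inj h]
  refine Finset.sum_congr rfl fun Y hY => ?_
  rw [← TorusPolymer.translate_sdiff, hF Y hY, hG Y hY]

/-- **`Φ` is covariant**: `Φ(X + a, τ_a φ, τ_a ξ) = Φ(X, φ, ξ)` for translation-invariant `I, Ĩ, K`
and `a ∈ (sℤ)^d`. [cite: AdamsBuchholzKoteckyMuller2019, Lemma 6.4 (1)] -/
theorem midK_translate {s t : ℕ} (hMst : M = s * t) (hs : Odd s) (ht : Odd t)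
    {I It K : Finset (Fin d → ZMod M) → ((Fin d → ZMod M) → ℝ) → 𝕜}
    (hI : TransInv s I) (hIt : TransInv s It) (hK : TransInv s K)
    {a : Fin d → ZMod M} (ha : IsLatticeVec s a) (X : Finset (Fin d → ZMod M))
    (φ ξ : (Fin d → ZMod M) → ℝ) :
    midK s I It K (TorusPolymer.translate a X) (fieldShift a φ) (fieldShift a ξ) = midK s I It K X φ ξ := by
  unfold midK
  refine pcirc_translate hMst hs ht ha _ _ _ _ X (fun Y _ => ?_) (fun Y _ => ?_)
  · simpa using bprod_translate hMst hs ht (F := fun B ψ => 1 - It B ψ)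
      (fun b hb B ψ => by simp only [hIt b hb B ψ]) ha Y φ
  · refine pcirc_translate hMst hs ht ha _ _ _ _ (X \ Y) (fun Z _ => ?_) (fun Z _ => ?_)
    · rw [← fieldShift_add]
      simpa using bprod_translate hMst hs ht (F := fun B ψ => I B ψ - 1)
        (fun b hb B ψ => by simp only [hI b hb B ψ]) ha Z (φ + ξ)
    · rw [← fieldShift_add]; exact hK a ha _ _

end Pieces

/-! ## The step measure is translation invariant -/

section StepMeasure

variable [NeZero M]

/-- The permutation matrix of `x ↦ x − a`: `(P_a ψ)(x) = ψ(x − a)`.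
[cite: AdamsBuchholzKoteckyMuller2019, Ch. 6.1 (translation-invariant covariances)] -/
def shiftMat (a : Fin d → ZMod M) : Matrix (Fin d → ZMod M) (Fin d → ZMod M) ℝ :=
  Matrix.of fun x y => if y = x - a then 1 else 0

/-- `P_a ψ = τ_a ψ`. [cite: AdamsBuchholzKoteckyMuller2019, Ch. 6.1] -/
theorem shiftMat_mulVec (a : Fin d → ZMod M) (ψ : (Fin d → ZMod M) → ℝ) :
    shiftMat a *ᵥ ψ = fieldShift a ψ := by
  funext x
  simp [shiftMat, Matrix.mulVec, dotProduct, fieldShift]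

/-- `(P_a C)(x, z) = C(x − a, z)`. [cite: AdamsBuchholzKoteckyMuller2019, Ch. 6.1] -/
theorem shiftMat_mul_apply (a : Fin d → ZMod M) (C : Matrix (Fin d → ZMod M) (Fin d → ZMod M) ℝ)
    (x z : Fin d → ZMod M) : (shiftMat a * C) x z = C (x - a) z := by
  simp [Matrix.mul_apply, shiftMat, ite_mul]

/-- `(C P_aᵀ)(x, y) = C(x, y − a)`. [cite: AdamsBuchholzKoteckyMuller2019, Ch. 6.1] -/
theorem mul_shiftMat_transpose_apply (a : Fin d → ZMod M) (C : Matrix (Fin d → ZMod M) (Fin d → ZMod M) ℝ)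
    (x y : Fin d → ZMod M) : (C * (shiftMat a)ᵀ) x y = C x (y - a) := by
  simp [Matrix.mul_apply, shiftMat, mul_ite]

/-- **`P_a (circulant 𝒞) P_aᵀ = circulant 𝒞`**: translation-invariant covariances are invariant
under the permutation `x ↦ x − a`. [cite: AdamsBuchholzKoteckyMuller2019, Ch. 6.1] -/
theorem shiftMat_mul_circulant_mul_transpose (a : Fin d → ZMod M) (𝒞 : (Fin d → ZMod M) → ℝ) :
    shiftMat a * Matrix.circulant 𝒞 * (shiftMat a)ᵀ = Matrix.circulant 𝒞 := by
  ext x y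
  rw [mul_shiftMat_transpose_apply, shiftMat_mul_apply, Matrix.circulant_apply, Matrix.circulant_apply]
  congr 1; abel

/-- **The step measure `N(0, circulant 𝒞)` is invariant under `τ_a`** (`circulant 𝒞 ⪰ 0`).
[cite: AdamsBuchholzKoteckyMuller2019, Ch. 6.1 (translation invariance of μ_{k+1})] -/
theorem map_fieldShift_stepMeasure {𝒞 : (Fin d → ZMod M) → ℝ} (hC : (Matrix.circulant 𝒞).PosSemidef)
    (a : Fin d → ZMod M) : (stepMeasure 𝒞).map (fieldShift a) = stepMeasure 𝒞 := by
  have hmeas : Measurable (fieldShift a : ((Fin d → ZMod M) → ℝ) → _) := (fieldShiftEquiv a).measurable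
  have hcomp : (fieldShift a) ∘ (WithLp.ofLp : EuclideanSpace ℝ (Fin d → ZMod M) → _) =
      WithLp.ofLp ∘ matrixCLM (shiftMat a) := by
    funext ψ
    simp only [Function.comp_apply, ofLp_matrixCLM, shiftMat_mulVec]
  rw [stepMeasure, Measure.map_map hmeas (PiLp.continuous_ofLp 2 _).measurable, hcomp,
    ← Measure.map_map (PiLp.continuous_ofLp 2 _).measurable (matrixCLM (shiftMat a)).continuous.measurable,
    multivariateGaussian_map_matrix hC, shiftMat_mul_circulant_mul_transpose]

omit [NeZero M] in
/-- **Integrals against a `τ`-invariant measure**: `∫ G(τ_a ξ) dμ = ∫ G dμ` (no measurability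
hypothesis: `τ_a` is a measurable equivalence). [cite: AdamsBuchholzKoteckyMuller2019, Lemma 6.4 (1)] -/
theorem integral_fieldShift_eq {E : Type*} [NormedAddCommGroup E] [NormedSpace ℝ E]
    {μ : Measure ((Fin d → ZMod M) → ℝ)} {a : Fin d → ZMod M} (hμ : μ.map (fieldShift a) = μ)
    (G : ((Fin d → ZMod M) → ℝ) → E) : ∫ ξ, G (fieldShift a ξ) ∂μ = ∫ ξ, G ξ ∂μ := by
  have h := integral_map_equiv (fieldShiftEquiv a) G (μ := μ)
  rw [coe_fieldShiftEquiv, hμ] at h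
  exact h.symm

end StepMeasure

/-! ## Lemma 6.4 (1) -/

section Main

variable [NeZero M] {𝕜 : Type*} [RCLike 𝕜]

/-- **Lemma 6.4 (1): `K_{k+1}` is translation invariant on scale `k+1`.**  For `c ∈ (s'ℤ)^d`
(`s' = L s`, odd torus `M = s'·t'`): `K_{k+1}(U + c, τ_c φ) = K_{k+1}(U, φ)`, provided `π` is
`(s'ℤ)^d`-covariant on `k`-polymers, `I, Ĩ, K` are translation invariant on scale `k`, and `μ` is
`τ_c`-invariant. [cite: AdamsBuchholzKoteckyMuller2019, Lemma 6.4 (1)] -/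
theorem nextK_translate {s s' t' : ℕ} (hMst : M = s' * t') (hs : Odd s) (hs' : Odd s') (ht' : Odd t')
    (hss : s ∣ s') {π : Finset (Fin d → ZMod M) → Finset (Fin d → ZMod M)}
    (hπ : ∀ c, IsLatticeVec s' c → ∀ X, IsPolymer s X → π (TorusPolymer.translate c X) = TorusPolymer.translate c (π X))
    {μ : Measure ((Fin d → ZMod M) → ℝ)}
    {I It K : Finset (Fin d → ZMod M) → ((Fin d → ZMod M) → ℝ) → 𝕜}
    (hI : TransInv s I) (hIt : TransInv s It) (hK : TransInv s K)
    {c : Fin d → ZMod M} (hc : IsLatticeVec s' c) (hμ : μ.map (fieldShift c) = μ)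
    (U : Finset (Fin d → ZMod M)) (φ : (Fin d → ZMod M) → ℝ) :
    nextK s π μ I It K (TorusPolymer.translate c U) (fieldShift c φ) = nextK s π μ I It K U φ := by
  -- `M = s·t` with `t` odd, and `c ∈ (sℤ)^d`
  obtain ⟨q, rfl⟩ := hss
  have hMst' : M = s * (q * t') := by rw [hMst, mul_assoc]
  have hqt : Odd (q * t') := (Nat.Odd.of_mul_right hs').mul ht'
  have hc' : IsLatticeVec s c := hc.of_dvd ⟨q, rfl⟩
  unfold nextK
  -- reindex the sum over `X` with `π X = U + c` by `X = X' + c`, `π X' = U`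
  have hfilter : (polys s univ).filter (fun X => π X = TorusPolymer.translate c U) =
      ((polys s univ).filter (fun X => π X = U)).image (TorusPolymer.translate c) := by
    ext X
    rw [mem_filter, mem_image]
    constructor
    · rintro ⟨hX, hπX⟩
      have hX' : TorusPolymer.translate (-c) X ∈ polys s univ := by
        have := polys_translate hMst' hs hqt hc'.neg (univ : Finset (Fin d → ZMod M))
        rw [translate_univ] at this
        rw [this]; exact mem_image_of_mem _ hX
      refine ⟨TorusPolymer.translate (-c) X, mem_filter.2 ⟨hX', ?_⟩, ?_⟩
      · have h1 := hπ c hc (TorusPolymer.translate (-c) X) (mem_polys.1 hX').2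
        rw [TorusPolymer.translate_translate, neg_add_cancel, TorusPolymer.translate_zero, hπX] at h1
        exact (TorusPolymer.translate_inj h1).symm
      · rw [TorusPolymer.translate_translate, neg_add_cancel, TorusPolymer.translate_zero]
    · rintro ⟨X', hX', rfl⟩
      obtain ⟨hX'p, hπX'⟩ := mem_filter.1 hX'
      refine ⟨?_, ?_⟩
      · have := polys_translate hMst' hs hqt hc' (univ : Finset (Fin d → ZMod M))
        rw [translate_univ] at this
        rw [this]; exact mem_image_of_mem _ hX'p
      · rw [hπ c hc X' (mem_polys.1 hX'p).2, hπX']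
  rw [hfilter, Finset.sum_image fun X _ X' _ h => TorusPolymer.translate_inj h]
  refine Finset.sum_congr rfl fun X hX => ?_
  rw [← TorusPolymer.translate_sdiff, ← TorusPolymer.translate_sdiff, bprod_translate hMst' hs hqt hIt hc',
    bprod_translate hMst' hs hqt hIt hc']
  congr 1
  rw [← integral_fieldShift_eq hμ (fun ξ => midK s I It K (TorusPolymer.translate c X) (fieldShift c φ) ξ)]
  exact integral_congr_ae (Filter.Eventually.of_forall fun ξ =>
    midK_translate hMst' hs hqt hI hIt hK hc' X φ ξ)

end Main

end Literature.MathematicalPhysics.StatisticalMechanics.GradientRG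

end
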